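import Summits.NavierStokesRegularity.NavierStokesRegularity.Theorems.AxisTwistDoorAveragedConeLiouvilleShellCore
import Summits.NavierStokesRegularity.NavierStokesRegularity.Theorems.AxisTwistDoorAveragedConeLiouvilleShellBookkeeping
import HarnessLib

/-!
# Route `AxisTwistDoor`, crux `AveragedConeLiouville` (stmt-NavierStokesRegularity-26889), line `lrt_shell` v4:
# the registered bridge stub `stub_shellOfLeiRen : ShellFactOfLeiRen`

The typed Lei–Ren fact `Literature.Analysis.FluidPDE.LeiRen2024_quantitative_regular_shells_cyl` (round cylinders;
Lei–Ren, Adv. Math. 445 (2024) 109654 = Lei–Ren–Tian arXiv:2501.08976 Lemma 2.4) implies the class-specialised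
`ShellFact` of the line: ns-cas-k2's bookkeeping `ShellBookkeeping.shellFact_of_leiRen_of_core` (uniform `G₀ ⇒ δ₀, B`,
shell membership, identification of the continuous profile with the regular-shell representative) fed with the
analytic core `ShellCore.shellCore_of_class` (pressure normalisation + the four masses from Albritton–Barker's `𝐈`).
Width seat ns-in-wu-341 g2 under LEAD ns-atd-p1.  [cite: LeiRenTian2025, Lemma 2.4; AlbrittonBarker2019, §1]

WHAT THIS IS NOT: not a statement about Navier–Stokes regularity; the crux `AveragedConeLiouville` (a Liouville-type
criterion about HYPOTHETICAL blow-up profiles), item 26889 and the summit remain OPEN; this closes one registered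
stub of the line `lrt_shell` only.
-/

noncomputable section

-- the summit and its single sub-problem share the name (CONVENTIONS §1)
set_option linter.dupNamespace false

namespace Summit.NavierStokesRegularity.NavierStokesRegularity.Theorems.AveragedConeLiouville.ShellOfLeiRen

open Summit.NavierStokesRegularity.NavierStokesRegularity.Theorems.AxisTwistDoorAveragedConeLiouvilleDefs

/-- **Registered stub `stub_shellOfLeiRen` of crux 26889 (line `lrt_shell` v4), exact signature `ShellFactOfLeiRen`:**
the typed Lei–Ren quantitative-regular-shell fact implies the class-specialised `ShellFact`.
Proof: `ShellBookkeeping.shellFact_of_leiRen_of_core` ∘ `ShellCore.shellCore_of_class`.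
[cite: LeiRenTian2025, Lemma 2.4 (arXiv:2501.08976, p. 7); AlbrittonBarker2019, §1] -/
theorem stub_shellOfLeiRen : ShellFactOfLeiRen := fun hLR =>
  ShellBookkeeping.shellFact_of_leiRen_of_core hLR ShellCore.shellCore_of_class

end Summit.NavierStokesRegularity.NavierStokesRegularity.Theorems.AveragedConeLiouville.ShellOfLeiRen

end
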